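import Literature.NumberTheory.PAdicHodge.AinfWeierstrassTateModuleIntegersSS
import Literature.NumberTheory.EllipticCurves.FormalGroupEtaHasseLocalProofs
import HarnessLib

/-!
# The η-Hasse criterion with `𝒪_F`-coefficients: `‖R_p(u)‖ = ‖u‖^p > ‖p‖` for the good model over a ramified base (proofs only)

Topic `Literature/NumberTheory/PAdicHodge`; namespace `Literature.NumberTheory.PAdicHodge.AinfTop`. THEOREMS ONLY (no definition, no named
fact, no instance, no `sorry`). The coefficient-side input of the η-period transversality `∫_τ η ∉ Fil¹ B_dR⁺` for the RAMIFIED good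
models of the potentially supersingular Kodaira cells (BSD route EdixhovenFibreFiveSeven, crux K★ `stmt-BirchSwinnertonDyer-22226`, road
item (R1); companion of `AinfWeierstrassEtaHasseCriterion` = the case `W/ℤ`).

For a series `f ∈ 𝒪_F⟦X⟧` (coefficients in the discrete copy `LTCoeff F`, evaluated on `𝔪_{ℂ_F} ⊂ 𝒪_{ℂ_F}` by the tree's `evalPt₁`)
and a point `u ∈ 𝔪_{ℂ_F}`:

* `aeval_eq_sum_add_pow_mul_O` — truncated evaluation `f(u) = Σ_{j≤n} f_j u^j + u^{n+1}·g(u)`;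
* **`norm_aeval_eq_norm_pow`** — if `‖f_j‖ ≤ ‖p‖` for `j < p`, `‖f_p‖ = 1` and `‖p‖ < ‖u‖^p`, then `‖f(u)‖ = ‖u‖^p` (isosceles principle),
  so **`evalPt₁_not_mem_span_p`** — `f(u) ∉ p·𝒪_{ℂ_F}`;
* **`mulDefect_evalPt₁_not_mem_span_p`** — for the good `𝒪_F`-model `W` (`Δ ∈ 𝒪_Fˣ`) with supersingular reduction at the odd residue
  characteristic `p` and ANY integral lift `Rn ∈ 𝒪_F⟦X⟧` of the multiplication defect `R_p(W ⊗ F)` of the quasi-period function: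
  `R_j ∈ p𝒪_F` (`j < p`) and `R_p ∈ 𝒪_Fˣ` (tree `FormalGroupEtaHasseLocalProofs`, via `W ⊗ 𝒪[F]`), hence **`R_p(u) ∉ p𝒪_{ℂ_F}` for every
  `u ∈ 𝔪_{ℂ_F}` with `‖p‖ < ‖u‖^p`** — such `u` among the `p`-torsion of `Ŵ(𝔪_{ℂ_F})` exist by `AinfWeierstrassRamifiedTorsionNorm`.

BSD is not proved by any of this.

## References
* P. Colmez, *Périodes p-adiques des variétés abéliennes*, Math. Ann. 292 (1992), §2. [Colmez1992PeriodesAbeliennes]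
* J. H. Silverman, *The Arithmetic of Elliptic Curves* (2009), IV.1, VII.2. [SilvermanAEC2009]
-/

noncomputable section

open scoped Classical NNReal
open Field ValuativeRel MvPowerSeries

namespace Literature.NumberTheory.PAdicHodge

open Literature.NumberTheory.GaloisRepresentations
open Literature.NumberTheory.GaloisRepresentations.IsNonarchimedeanLocalField
open Literature.NumberTheory.GaloisRepresentations.LubinTate
open Literature.NumberTheory.EllipticCurves

namespace AinfTop

variable {F : Type} [Field F] [ValuativeRel F] [TopologicalSpace F] [IsNonarchimedeanLocalField F]
  {p : ℕ} [Fact p.Prime]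

/-! ## §1 Truncated evaluation and the norm criterion -/

/-- **Truncated evaluation** with `𝒪_F`-coefficients: `f(u) = Σ_{j≤n} f_j u^j + u^{n+1}·g(u)` for `f ∈ 𝒪_F⟦X⟧`, `u ∈ 𝔪_{ℂ_F}`.
[cite: SilvermanAEC2009, IV.1] -/
theorem aeval_eq_sum_add_pow_mul_O (f : PowerSeries (LTCoeff F)) (n : ℕ) (u : (maxNilIdealC F).toIdeal) :
    ∃ G : CBall F, aeval ((maxNilIdealC F).hasEval fun _ : Unit => u) f =
      ∑ j ∈ Finset.range (n + 1), algebraMap (LTCoeff F) (CBall F) (PowerSeries.coeff j f) * (u : CBall F) ^ j +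
        (u : CBall F) ^ (n + 1) * G := by
  set P : PowerSeries (LTCoeff F) :=
    ∑ j ∈ Finset.range (n + 1), PowerSeries.C (PowerSeries.coeff j f) * PowerSeries.X ^ j with hP
  have hdvd : (PowerSeries.X : PowerSeries (LTCoeff F)) ^ (n + 1) ∣ f - P := by
    rw [PowerSeries.X_pow_dvd_iff]
    intro m hm
    rw [map_sub, hP, map_sum]
    simp_rw [PowerSeries.coeff_C_mul_X_pow]
    rw [Finset.sum_ite_eq, if_pos (Finset.mem_range.2 hm), sub_self]
  obtain ⟨g, hg⟩ := hdvd
  have hx := (maxNilIdealC F).hasEval fun _ : Unit => u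
  have hX : aeval hx (PowerSeries.X : PowerSeries (LTCoeff F)) = (u : CBall F) := aeval_X' hx ()
  have hC : ∀ c : LTCoeff F, aeval hx (PowerSeries.C c) = algebraMap (LTCoeff F) (CBall F) c := fun c => by
    rw [PowerSeries.C_eq_algebraMap]; exact (aeval hx).commutes c
  refine ⟨aeval hx g, ?_⟩
  have hdec : f = P + PowerSeries.X ^ (n + 1) * g := by rw [← hg]; ring
  conv_lhs => rw [hdec]
  rw [map_add, map_mul, map_pow, hX, hP, map_sum]
  congr 1
  refine Finset.sum_congr rfl fun j _ => ?_
  rw [map_mul, map_pow, hX, hC]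

/-- **The norm criterion `‖f(u)‖ = ‖u‖^p`**: if `‖f_j‖ ≤ ‖p‖` for `j < p`, `‖f_p‖ = 1`, `u ∈ 𝔪_{ℂ_F}` and `‖p‖ < ‖u‖^p`, then the term
`f_p u^p` dominates: `‖Σ_{j<p} f_j u^j‖ ≤ ‖p‖ < ‖u‖^p` and `‖u^{p+1}g(u)‖ < ‖u‖^p`. [cite: Colmez1992PeriodesAbeliennes, §2] -/
theorem norm_aeval_eq_norm_pow (f : PowerSeries (LTCoeff F)) (u : (maxNilIdealC F).toIdeal)
    (hlow : ∀ j, j < p → ‖((algebraMap (LTCoeff F) (CBall F) (PowerSeries.coeff j f) : CBall F) : CompletedAlgClosure F)‖ ≤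
      ‖(p : CompletedAlgClosure F)‖)
    (htop : ‖((algebraMap (LTCoeff F) (CBall F) (PowerSeries.coeff p f) : CBall F) : CompletedAlgClosure F)‖ = 1)
    (hpu : ‖(p : CompletedAlgClosure F)‖ < ‖((u : CBall F) : CompletedAlgClosure F)‖ ^ p) :
    ‖((aeval ((maxNilIdealC F).hasEval fun _ : Unit => u) f : CBall F) : CompletedAlgClosure F)‖ =
      ‖((u : CBall F) : CompletedAlgClosure F)‖ ^ p := by
  have hp : p.Prime := Fact.out
  set x : CompletedAlgClosure F := ((u : CBall F) : CompletedAlgClosure F) with hx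
  have hx1 : ‖x‖ < 1 := u.2
  have hxp : 0 < ‖x‖ ^ p := lt_of_le_of_lt (norm_nonneg _) hpu
  have hxpos : 0 < ‖x‖ := by
    rcases (norm_nonneg x).eq_or_lt with h | h
    · rw [← h, zero_pow hp.ne_zero] at hxp; exact absurd hxp (lt_irrefl 0)
    · exact h
  obtain ⟨G, hG⟩ := aeval_eq_sum_add_pow_mul_O f p u
  -- push to `ℂ_F`
  have hC : (((aeval ((maxNilIdealC F).hasEval fun _ : Unit => u) f : CBall F) : CompletedAlgClosure F)) =
      ∑ j ∈ Finset.range (p + 1), ((algebraMap (LTCoeff F) (CBall F) (PowerSeries.coeff j f) : CBall F) : CompletedAlgClosure F) * x ^ j +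
        x ^ (p + 1) * (G : CompletedAlgClosure F) := by
    have h := congrArg ((CBall F).subtype) hG
    rw [map_add, map_sum, map_mul, map_pow] at h
    simp only [map_mul, map_pow, Subring.coe_subtype] at h
    exact h
  rw [hC, Finset.sum_range_succ]
  -- norms of the three parts
  set A := ((algebraMap (LTCoeff F) (CBall F) (PowerSeries.coeff p f) : CBall F) : CompletedAlgClosure F) * x ^ p with hA
  set B := ∑ j ∈ Finset.range p, ((algebraMap (LTCoeff F) (CBall F) (PowerSeries.coeff j f) : CBall F) : CompletedAlgClosure F) * x ^ j with hB
  set Cc := x ^ (p + 1) * (G : CompletedAlgClosure F) with hCc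
  have hAn : ‖A‖ = ‖x‖ ^ p := by rw [hA, norm_mul, norm_pow, htop, one_mul]
  have hBn : ‖B‖ < ‖x‖ ^ p := by
    refine lt_of_le_of_lt ?_ hpu
    refine IsUltrametricDist.norm_sum_le_of_forall_le_of_nonneg (norm_nonneg _) fun j hj => ?_
    rw [Finset.mem_range] at hj
    rw [norm_mul, norm_pow]
    calc ‖((algebraMap (LTCoeff F) (CBall F) (PowerSeries.coeff j f) : CBall F) : CompletedAlgClosure F)‖ * ‖x‖ ^ j
        ≤ ‖(p : CompletedAlgClosure F)‖ * 1 :=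
          mul_le_mul (hlow j hj) (pow_le_one₀ (norm_nonneg _) hx1.le) (by positivity) (norm_nonneg _)
      _ = _ := mul_one _
  have hCn : ‖Cc‖ < ‖x‖ ^ p := by
    rw [hCc, norm_mul, norm_pow, pow_succ]
    calc ‖x‖ ^ p * ‖x‖ * ‖(G : CompletedAlgClosure F)‖ ≤ ‖x‖ ^ p * ‖x‖ * 1 := by
          gcongr; exact (mem_unitBall_iff _).mp G.2
      _ < ‖x‖ ^ p * 1 * 1 := by gcongr
      _ = _ := by rw [mul_one, mul_one]
  -- isosceles twice
  have h1 : ‖B + A‖ = ‖x‖ ^ p := by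
    rw [add_comm, IsUltrametricDist.norm_add_eq_max_of_norm_ne_norm (by rw [hAn]; exact (ne_of_gt hBn)), hAn,
      max_eq_left hBn.le]
  rw [IsUltrametricDist.norm_add_eq_max_of_norm_ne_norm (by rw [h1]; exact ne_of_gt hCn), h1, max_eq_left hCn.le]

/-- **`f(u) ∉ p𝒪_{ℂ_F}`** under the hypotheses of `norm_aeval_eq_norm_pow` (`‖f(u)‖ = ‖u‖^p > ‖p‖ ≥ ‖p·c‖`).
[cite: Colmez1992PeriodesAbeliennes, §2] -/
theorem evalPt₁_not_mem_span_p (f : PowerSeries (LTCoeff F)) (hf0 : PowerSeries.constantCoeff f = 0) (u : (maxNilIdealC F).toIdeal)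
    (hlow : ∀ j, j < p → ‖((algebraMap (LTCoeff F) (CBall F) (PowerSeries.coeff j f) : CBall F) : CompletedAlgClosure F)‖ ≤
      ‖(p : CompletedAlgClosure F)‖)
    (htop : ‖((algebraMap (LTCoeff F) (CBall F) (PowerSeries.coeff p f) : CBall F) : CompletedAlgClosure F)‖ = 1)
    (hpu : ‖(p : CompletedAlgClosure F)‖ < ‖((u : CBall F) : CompletedAlgClosure F)‖ ^ p) :
    (evalPt₁ (maxNilIdealC F) f hf0 u : CBall F) ∉ Ideal.span {(p : CBall F)} := by
  intro hmem
  obtain ⟨c, hc⟩ := Ideal.mem_span_singleton'.mp hmem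
  have hnorm := norm_aeval_eq_norm_pow f u hlow htop hpu
  have heval : (evalPt₁ (maxNilIdealC F) f hf0 u : CBall F) = aeval ((maxNilIdealC F).hasEval fun _ : Unit => u) f := rfl
  rw [← heval, ← hc, Subring.coe_mul, norm_mul] at hnorm
  have hle : ‖((c : CBall F) : CompletedAlgClosure F)‖ * ‖(((p : CBall F)) : CompletedAlgClosure F)‖ ≤
      ‖(p : CompletedAlgClosure F)‖ := by
    calc _ ≤ 1 * ‖(((p : CBall F)) : CompletedAlgClosure F)‖ := by gcongr; exact (mem_unitBall_iff _).mp c.2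
      _ = _ := by rw [one_mul]; rfl
  rw [hnorm] at hle
  exact absurd hpu (not_lt.mpr hle)

/-! ## §2 The multiplication defect of the good `𝒪_F`-model -/

/-- Units of `𝒪_F` have norm `1` in `ℂ_F`. [cite: SilvermanAEC2009, VII.§1] -/
theorem norm_algebraMap_ltCoeff_eq_one_of_isUnit {a : LTCoeff F} (ha : IsUnit a) :
    ‖((algebraMap (LTCoeff F) (CBall F) a : CBall F) : CompletedAlgClosure F)‖ = 1 := by
  obtain ⟨v, rfl⟩ := ha
  have hle : ∀ b : LTCoeff F, ‖((algebraMap (LTCoeff F) (CBall F) b : CBall F) : CompletedAlgClosure F)‖ ≤ 1 :=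
    fun b => (mem_unitBall_iff _).mp (algebraMap (LTCoeff F) (CBall F) b).2
  have h1 : ‖((algebraMap (LTCoeff F) (CBall F) (v : LTCoeff F) : CBall F) : CompletedAlgClosure F)‖ *
      ‖((algebraMap (LTCoeff F) (CBall F) (↑v⁻¹ : LTCoeff F) : CBall F) : CompletedAlgClosure F)‖ = 1 := by
    rw [← norm_mul, ← Subring.coe_mul, ← map_mul, Units.mul_inv, map_one, OneMemClass.coe_one, norm_one]
  have ha := hle (v : LTCoeff F)
  have hb := hle (↑v⁻¹ : LTCoeff F)
  nlinarith [norm_nonneg (((algebraMap (LTCoeff F) (CBall F) (v : LTCoeff F) : CBall F) : CompletedAlgClosure F)),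
    norm_nonneg (((algebraMap (LTCoeff F) (CBall F) (↑v⁻¹ : LTCoeff F) : CBall F) : CompletedAlgClosure F))]

omit [Fact p.Prime] in
/-- Elements of `p𝒪_F` have norm `≤ ‖p‖` in `ℂ_F`. [cite: SilvermanAEC2009, VII.§1] -/
theorem norm_algebraMap_ltCoeff_le_of_mem_span {a : LTCoeff F} (ha : a ∈ Ideal.span {(p : LTCoeff F)}) :
    ‖((algebraMap (LTCoeff F) (CBall F) a : CBall F) : CompletedAlgClosure F)‖ ≤ ‖(p : CompletedAlgClosure F)‖ := by
  obtain ⟨c, rfl⟩ := Ideal.mem_span_singleton'.mp ha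
  rw [map_mul, map_natCast, Subring.coe_mul, norm_mul]
  calc _ ≤ 1 * ‖(((p : CBall F)) : CompletedAlgClosure F)‖ := by
        gcongr; exact (mem_unitBall_iff _).mp (algebraMap (LTCoeff F) (CBall F) c).2
    _ = _ := by rw [one_mul]; rfl

variable [CharZero F] [CharP 𝓀[F] p] (W : WeierstrassCurve (LTCoeff F))

/-- **`R_p ∈ 𝒪_Fˣ` and `R_j ∈ p𝒪_F` (`j < p`) for the good `𝒪_F`-model at supersingular reduction**: any integral lift `Rn ∈ 𝒪_F⟦X⟧` of
`R_p(W ⊗ F)` (tree `FormalGroupEtaHasseLocalProofs`, applied to `W ⊗ 𝒪[F]` along `𝒪[F] ↪ F`). [cite: Colmez1992PeriodesAbeliennes, §2] -/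
theorem isUnit_coeff_prime_mulDefect_O (hp2 : p ≠ 2) (hΔ : IsUnit W.Δ) (hA : (W.map (redCoeff F)).hasseCoeff p = 0)
    {Rn : PowerSeries (LTCoeff F)}
    (hRn : PowerSeries.map (algebraMap (LTCoeff F) F) Rn = (W.map (algebraMap (LTCoeff F) F)).formalQuasiPeriodMulDefect p) :
    IsUnit (PowerSeries.coeff p Rn) ∧ ∀ j < p, PowerSeries.coeff j Rn ∈ Ideal.span {(p : LTCoeff F)} := by
  set ρ : LTCoeff F ≃+* 𝒪[F] := (LTCoeff.of F).symm with hρ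
  have hφρ : (algebraMap 𝒪[F] F).comp ρ.toRingHom = algebraMap (LTCoeff F) F := RingHom.ext fun _ => rfl
  have hinj : Function.Injective (algebraMap 𝒪[F] F) := fun _ _ h => Subtype.ext h
  have hRn' : PowerSeries.map (algebraMap 𝒪[F] F) (PowerSeries.map ρ.toRingHom Rn) =
      ((W.map ρ.toRingHom).map (algebraMap 𝒪[F] F)).formalQuasiPeriodMulDefect p := by
    rw [show PowerSeries.map (algebraMap 𝒪[F] F) (PowerSeries.map ρ.toRingHom Rn) =
        PowerSeries.map ((algebraMap 𝒪[F] F).comp ρ.toRingHom) Rn by rw [PowerSeries.map_comp]; rfl,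
      WeierstrassCurve.map_map, hφρ, hRn]
  have hΔ' : IsUnit (W.map ρ.toRingHom).Δ := by rw [WeierstrassCurve.map_Δ]; exact hΔ.map _
  have hA' : ((W.map ρ.toRingHom).map (IsLocalRing.residue 𝒪[F])).hasseCoeff p = 0 := by
    rw [WeierstrassCurve.map_map]; exact hA
  obtain ⟨hu, hl⟩ := (W.map ρ.toRingHom).isUnit_coeff_prime_of_map_eq_formalQuasiPeriodMulDefect hinj hp2 hΔ' hA' hRn'
  refine ⟨?_, fun j hj => ?_⟩
  · rw [PowerSeries.coeff_map] at hu
    simpa using hu.map ρ.symm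
  · have h := Ideal.mem_map_of_mem ρ.symm.toRingHom (hl j hj)
    rw [PowerSeries.coeff_map, Ideal.map_span, Set.image_singleton, map_natCast] at h
    simpa using h

/-- **The η-Hasse transversality input with ramified coefficients: `R_p(u) ∉ p𝒪_{ℂ_F}`** for the good `𝒪_F`-model `W` with supersingular
reduction at the odd residue characteristic `p`, any integral lift `Rn` of `R_p(W ⊗ F)`, and every `u ∈ 𝔪_{ℂ_F}` with `‖p‖ < ‖u‖^p`
(`‖R_p(u)‖ = ‖u‖^p`). [cite: Colmez1992PeriodesAbeliennes, §2] -/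
theorem mulDefect_evalPt₁_not_mem_span_p (hp2 : p ≠ 2) (hΔ : IsUnit W.Δ) (hA : (W.map (redCoeff F)).hasseCoeff p = 0)
    {Rn : PowerSeries (LTCoeff F)}
    (hRn : PowerSeries.map (algebraMap (LTCoeff F) F) Rn = (W.map (algebraMap (LTCoeff F) F)).formalQuasiPeriodMulDefect p)
    (hRn0 : PowerSeries.constantCoeff Rn = 0) (u : (maxNilIdealC F).toIdeal)
    (hpu : ‖(p : CompletedAlgClosure F)‖ < ‖((u : CBall F) : CompletedAlgClosure F)‖ ^ p) :
    (evalPt₁ (maxNilIdealC F) Rn hRn0 u : CBall F) ∉ Ideal.span {(p : CBall F)} := by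
  obtain ⟨hu, hl⟩ := isUnit_coeff_prime_mulDefect_O W hp2 hΔ hA hRn
  exact evalPt₁_not_mem_span_p Rn hRn0 u (fun j hj => norm_algebraMap_ltCoeff_le_of_mem_span (hl j hj))
    (norm_algebraMap_ltCoeff_eq_one_of_isUnit hu) hpu

end AinfTop

end Literature.NumberTheory.PAdicHodge

end
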